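import Mathlib
import Summits.NavierStokesRegularity.NavierStokesRegularity.Theorems.EulerZoomLiouvillePowerGaugeEulerLiouvilleSelfSimilarNoDrift
import Summits.NavierStokesRegularity.NavierStokesRegularity.Theorems.EulerZoomLiouvillePowerGaugeEulerLiouvilleSelfSimilarNoDriftBadNodeTools
import Summits.NavierStokesRegularity.NavierStokesRegularity.Theorems.EulerZoomLiouvillePowerGaugeEulerLiouvilleSelfSimilarSaddleContinuum
import Literature.Analysis.FluidPDE.SelfSimilarEulerOutgoingFlatVorticity
import Literature.Analysis.FluidPDE.SelfSimilarEulerProfileVorticity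
import HarnessLib.Audit

/-!
# Rung C1 of the crux `EulerZoomLiouville.PowerGaugeEulerLiouville`, NO-DRIFT lane (3d/3): EVERY VORTICAL PARTICLE'S
# BACKWARD TRAJECTORY CONVERGES TO ONE (BAD) STAGNATION POINT — unconditionally, for classical in-window profiles

Route №10 `EulerZoomLiouville` (NavierStokesRegularity), crux E = stmt-NavierStokesRegularity-19832, tenure rung C1,
registered residue `stub_selfSimilarExtremalRest`.  Lineage ns-typeII-p2 (gen 7).  Setting of the `Kelvin` files:
`0 < γ < ½`, `V` smooth, `W = γy + V`, `Φ` its flow.  The bordered hypothesis of `tendsto_flow_atBot_of_bordered_clusterPt`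
(3b) is verified at every limit node that ns-typeII-p1's LIMIT-SET KILL provides:

* `tendsto_flow_atBot_of_nonvortical_badClusterPt` — a NON-VORTICAL BAD limit node (`curl V z₀ = 0`, `⟪DV(z₀)w,w⟫ ≥ 1`):
  isolated ⇒ the preconnected limit set is `{z₀}`; non-isolated ⇒ `DW(z₀)` symmetric, `tr = 3γ < 1+γ ≤ top`, so its
  kernel is the line of the kernel vector supplied by the accumulating zeros (`ker_inter_orth_eq_zero_of_bad`);
* `tendsto_flow_atBot_of_vortical_clusterPt` — a VORTICAL limit node (`curl V z₀ ≠ 0`): `DW(z₀) Ω = (1+γ)Ω`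
  (tree `fderiv_apply_curl_eq_of_mem_nodalSet`), `tr DW = 3γ`, `2γ − 1 ≠ 0` (`exists_borderedEquiv_of_eigen_simple`);
* `tendsto_flow_atBot_of_badClusterPt` — either case;
* **`tendsto_flow_atBot_of_curl_ne_zero` — `0 < γ < ½`, `V` smooth with CIV's far field (3.8): the backward trajectory
  of every VORTICAL point `x` (`curl V x ≠ 0`) CONVERGES to a single stagnation point, which is BAD** (p1's
  `exists_badNode_mapClusterPt_of_curl_ne_zero` gives a bad limit node; the two previous items give convergence; the
  limit is that node).

With this, hypothesis (i) («drift coordinate») of ns-typeII-p3's `eq_zero_of_driftCoordinate_of_dominatedBlock_badNodes`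
is no longer needed for vortical particles: the unconditional C1-classical theorem now only wants null backward basins
at EVERY bad node (p3's dominated-block lemma covers real simple dominated contracting directions; spiral vortical nodes
and double negative eigenvalues need the 2-dimensional-stable-direction wrapper) and the assembly `{curl V ≠ 0} ⊆ ⋃ basins`.
WHAT THIS IS NOT: not NS, not E, not rung C1 — convergence of backward trajectories of classical profiles.
[folklore; ConstantinIgnatovaVicol2026Putative §3.5 (proofs of Thm 3.8 / Prop 3.9: `DU Ω = Ω`, `∇U = 𝕊` at nodes)]
-/

noncomputable section

-- flat `Theorems/<Route><Decl>…` files of one crux share the namespace of the crux (tree convention)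
set_option linter.dupNamespace false

open MeasureTheory Set Filter Topology Metric Function InnerProductSpace
open scoped RealInnerProductSpace NNReal ContDiff

namespace Summit.NavierStokesRegularity.NavierStokesRegularity.Theorems.PowerGaugeEulerLiouville.NoDrift

open Literature.Analysis Literature.Analysis.FluidPDE
open Summit.NavierStokesRegularity.NavierStokesRegularity.Theorems.PowerGaugeEulerLiouville.Kelvin

/-! ### Backward trajectories clustering at a non-vortical bad node converge -/

section Profile

variable {γ : ℝ} {V : EuclideanSpace ℝ (Fin 3) → EuclideanSpace ℝ (Fin 3)} {P : EuclideanSpace ℝ (Fin 3) → ℝ}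

/-- **NO DRIFT AT A NON-VORTICAL BAD LIMIT NODE (unconditional).**  `0 < γ < ½`, `V` smooth bounded with `‖DV‖ ≤ K`,
`P ≤ P₀`, `(V, P)` a self-similar Euler profile.  If a backward limit point `z₀` of `x` is a NON-VORTICAL
(`curl V z₀ = 0`) BAD (`⟪DV(z₀) w, w⟫ ≥ 1`, `‖w‖ = 1`) node — the limit node that ns-typeII-p1's LIMIT-SET KILL attaches
to every vortical particle, when it is non-vortical — then the backward trajectory of `x` converges to a stagnation
point: an isolated `z₀` is the whole (preconnected) limit set; at a non-isolated one `DW(z₀) = γI + DV(z₀)` is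
symmetric with trace `3γ < 1 + γ ≤` its top eigenvalue, so its kernel is the line of a unit kernel vector supplied by
the accumulating zeros, the bordered operator is invertible, and `tendsto_flow_atBot_of_bordered_clusterPt` applies.
[folklore; ConstantinIgnatovaVicol2026Putative §3.5 proof of Prop. 3.9 (∇U = 𝕊 at a non-vortical node)] -/
theorem tendsto_flow_atBot_of_nonvortical_badClusterPt (hV : ContDiff ℝ ∞ V) {K : ℝ}
    (hK : ∀ y, ‖fderiv ℝ V y‖ ≤ K) (hprof : IsSelfSimilarEulerProfile γ 0 V P) {M P₀ : ℝ} (hM : ∀ y, ‖V y‖ ≤ M)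
    (hP : ∀ y, P y ≤ P₀) (hγ : 0 < γ) (hγ2 : γ < 1 / 2) (x : EuclideanSpace ℝ (Fin 3))
    {z₀ : EuclideanSpace ℝ (Fin 3)}
    (hz₀ : MapClusterPt z₀ atBot fun s => ODE.evolutionMap (fun _ : ℝ => selfSimilarTransport γ 0 V) 0 s x)
    (hΩ : curl V z₀ = 0) {w : EuclideanSpace ℝ (Fin 3)} (hw : ‖w‖ = 1) (hbad : 1 ≤ ⟪fderiv ℝ V z₀ w, w⟫) :
    ∃ z ∈ selfSimilarNodalSet γ 0 V,
      Tendsto (fun s => ODE.evolutionMap (fun _ : ℝ => selfSimilarTransport γ 0 V) 0 s x) atBot (𝓝 z) := by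
  set W := selfSimilarTransport γ 0 V with hWdef
  set Φ := ODE.evolutionMap (fun _ : ℝ => W) 0 with hΦdef
  have hVd : Differentiable ℝ V := hV.differentiable (by simp)
  -- compact tail, continuity, limit points are nodes
  set B : ℝ := max 1 ((γ * M + |1 / 2 * M ^ 2 + P₀| + |selfSimilarBernoulli γ 0 V P x| + 1) / (γ * (1 / 2 - γ)))
    with hB
  have hKc : IsCompact (closedBall (0 : EuclideanSpace ℝ (Fin 3)) B) := isCompact_closedBall 0 B
  have htail : ∀ᶠ s in atBot, Φ s x ∈ closedBall (0 : EuclideanSpace ℝ (Fin 3)) B := by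
    filter_upwards [eventually_le_atBot (0 : ℝ)] with s hs
    rw [mem_closedBall, dist_zero_right, hB]
    exact norm_flow_le_of_nonpos hV hK hprof hM hP hγ hγ2 x hs
  have hcont : Continuous fun s => Φ s x := continuous_flow_apply (γ := γ) hV hK x
  have hN : ∀ z, MapClusterPt z atBot (fun s => Φ s x) → z ∈ selfSimilarNodalSet γ 0 V :=
    fun z hz => mem_nodalSet_of_mapClusterPt_atBot hV hK hprof hM hP hγ hγ2 hz
  have hz₀N : W z₀ = 0 := hN z₀ hz₀
  by_cases hiso : ∃ r : ℝ, 0 < r ∧ ∀ y ∈ selfSimilarNodalSet γ 0 V, dist y z₀ < r → y = z₀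
  · obtain ⟨r, hr, hiso⟩ := hiso
    exact ⟨z₀, hN z₀ hz₀, tendsto_of_isolated_mapClusterPt hcont hKc htail hN hz₀ hr hiso⟩
  -- non-isolated: a unit kernel vector of `DW(z₀)`
  push Not at hiso
  have hDV : fderiv ℝ W z₀ = γ • ContinuousLinearMap.id ℝ _ + fderiv ℝ V z₀ :=
    (hasFDerivAt_selfSimilarTransport (γ := γ) (c := 0) hVd z₀).fderiv
  have hWd : HasFDerivAt W (fderiv ℝ W z₀) z₀ := by
    rw [hDV]; exact hasFDerivAt_selfSimilarTransport (γ := γ) (c := 0) hVd z₀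
  obtain ⟨e, he, hLe⟩ := exists_unit_kernel_of_accumulating_zeros hWd hz₀N fun r hr => by
    obtain ⟨y, hy, hdist, hne⟩ := hiso r hr
    exact ⟨y, hne, hdist, hy⟩
  -- `DW(z₀)` is symmetric with trace `3γ` and `⟪DW w, w⟫ ≥ 1 + γ`
  have hS := isSymmetric_fderiv_of_curl_eq_zero (hVd z₀) hΩ
  have hLsym : ((fderiv ℝ W z₀ : EuclideanSpace ℝ (Fin 3) →L[ℝ] EuclideanSpace ℝ (Fin 3)) :
      EuclideanSpace ℝ (Fin 3) →ₗ[ℝ] EuclideanSpace ℝ (Fin 3)).IsSymmetric := by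
    rw [hDV]
    intro u v
    have hSuv := hS u v
    simp only [ContinuousLinearMap.coe_coe] at hSuv
    simp only [ContinuousLinearMap.coe_coe, add_apply, FunLike.coe_smul, Pi.smul_apply,
      ContinuousLinearMap.id_apply, inner_add_left, inner_add_right, real_inner_smul_left, real_inner_smul_right]
    rw [hSuv]
  have htr : LinearMap.trace ℝ _ ((fderiv ℝ W z₀ : EuclideanSpace ℝ (Fin 3) →L[ℝ] EuclideanSpace ℝ (Fin 3)) :
      EuclideanSpace ℝ (Fin 3) →ₗ[ℝ] EuclideanSpace ℝ (Fin 3)) = 3 * γ := by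
    have hdiv : LinearMap.trace ℝ _ ((fderiv ℝ V z₀ : EuclideanSpace ℝ (Fin 3) →L[ℝ] EuclideanSpace ℝ (Fin 3)) :
        EuclideanSpace ℝ (Fin 3) →ₗ[ℝ] EuclideanSpace ℝ (Fin 3)) = 0 := hprof.divFree z₀
    rw [hDV, ContinuousLinearMap.toLinearMap_add, ContinuousLinearMap.toLinearMap_smul, map_add,
      map_smul, hdiv, ContinuousLinearMap.coe_id, LinearMap.trace_id, finrank_euclideanSpace,
      Fintype.card_fin]
    norm_num [smul_eq_mul]
    ring
  have hbadW : 1 + γ ≤ ⟪fderiv ℝ W z₀ w, w⟫ := by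
    rw [hDV]
    simp only [add_apply, FunLike.coe_smul, Pi.smul_apply, ContinuousLinearMap.id_apply,
      inner_add_left, real_inner_smul_left, real_inner_self_eq_norm_sq, hw]
    linarith
  have hker := ker_inter_orth_eq_zero_of_bad hLsym hγ.le hγ2 htr hw hbadW he hLe
  obtain ⟨T, hT⟩ := exists_borderedEquiv_of_isSymmetric hLsym he hLe hker
  exact tendsto_flow_atBot_of_bordered_clusterPt hV hK hprof hM hP hγ hγ2 x hz₀ he hLe T hT

/-- **NO DRIFT AT A VORTICAL LIMIT NODE (unconditional).**  Same setting; if a backward limit point `z₀` of `x` is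
VORTICAL (`curl V z₀ ≠ 0`), the backward trajectory of `x` converges to a stagnation point: isolated ⇒ as before;
non-isolated ⇒ `DW(z₀) Ω(z₀) = (1+γ) Ω(z₀)` (CIV: `DU Ω = Ω` at a node), `DW(z₀) e = 0` for a unit kernel vector, and
`tr DW(z₀) − (1+γ) = 2γ − 1 ≠ 0`, so `exists_borderedEquiv_of_eigen_simple` and 3b apply.
[cite: ConstantinIgnatovaVicol2026Putative, §3.5 proof of Thm. 3.8 (`DU(y_*)Ω(y_*) = Ω(y_*)`)] -/
theorem tendsto_flow_atBot_of_vortical_clusterPt (hV : ContDiff ℝ ∞ V) {K : ℝ}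
    (hK : ∀ y, ‖fderiv ℝ V y‖ ≤ K) (hprof : IsSelfSimilarEulerProfile γ 0 V P) {M P₀ : ℝ} (hM : ∀ y, ‖V y‖ ≤ M)
    (hP : ∀ y, P y ≤ P₀) (hγ : 0 < γ) (hγ2 : γ < 1 / 2) (x : EuclideanSpace ℝ (Fin 3))
    {z₀ : EuclideanSpace ℝ (Fin 3)}
    (hz₀ : MapClusterPt z₀ atBot fun s => ODE.evolutionMap (fun _ : ℝ => selfSimilarTransport γ 0 V) 0 s x)
    (hΩ : curl V z₀ ≠ 0) :
    ∃ z ∈ selfSimilarNodalSet γ 0 V,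
      Tendsto (fun s => ODE.evolutionMap (fun _ : ℝ => selfSimilarTransport γ 0 V) 0 s x) atBot (𝓝 z) := by
  set W := selfSimilarTransport γ 0 V with hWdef
  set Φ := ODE.evolutionMap (fun _ : ℝ => W) 0 with hΦdef
  have hVd : Differentiable ℝ V := hV.differentiable (by simp)
  set B : ℝ := max 1 ((γ * M + |1 / 2 * M ^ 2 + P₀| + |selfSimilarBernoulli γ 0 V P x| + 1) / (γ * (1 / 2 - γ)))
    with hB
  have hKc : IsCompact (closedBall (0 : EuclideanSpace ℝ (Fin 3)) B) := isCompact_closedBall 0 B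
  have htail : ∀ᶠ s in atBot, Φ s x ∈ closedBall (0 : EuclideanSpace ℝ (Fin 3)) B := by
    filter_upwards [eventually_le_atBot (0 : ℝ)] with s hs
    rw [mem_closedBall, dist_zero_right, hB]
    exact norm_flow_le_of_nonpos hV hK hprof hM hP hγ hγ2 x hs
  have hcont : Continuous fun s => Φ s x := continuous_flow_apply (γ := γ) hV hK x
  have hN : ∀ z, MapClusterPt z atBot (fun s => Φ s x) → z ∈ selfSimilarNodalSet γ 0 V :=
    fun z hz => mem_nodalSet_of_mapClusterPt_atBot hV hK hprof hM hP hγ hγ2 hz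
  have hz₀N : z₀ ∈ selfSimilarNodalSet γ 0 V := hN z₀ hz₀
  by_cases hiso : ∃ r : ℝ, 0 < r ∧ ∀ y ∈ selfSimilarNodalSet γ 0 V, dist y z₀ < r → y = z₀
  · obtain ⟨r, hr, hiso⟩ := hiso
    exact ⟨z₀, hz₀N, tendsto_of_isolated_mapClusterPt hcont hKc htail hN hz₀ hr hiso⟩
  push Not at hiso
  have hDV : fderiv ℝ W z₀ = γ • ContinuousLinearMap.id ℝ _ + fderiv ℝ V z₀ :=
    (hasFDerivAt_selfSimilarTransport (γ := γ) (c := 0) hVd z₀).fderiv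
  have hWd : HasFDerivAt W (fderiv ℝ W z₀) z₀ := by
    rw [hDV]; exact hasFDerivAt_selfSimilarTransport (γ := γ) (c := 0) hVd z₀
  obtain ⟨e, he, hLe⟩ := exists_unit_kernel_of_accumulating_zeros hWd hz₀N fun r hr => by
    obtain ⟨y, hy, hdist, hne⟩ := hiso r hr
    exact ⟨y, hne, hdist, hy⟩
  -- the vorticity is an eigenvector with eigenvalue `1 + γ`
  have hAω : fderiv ℝ W z₀ (curl V z₀) = (1 + γ) • curl V z₀ := by
    rw [hDV, add_apply, FunLike.coe_smul, Pi.smul_apply, ContinuousLinearMap.id_apply,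
      hprof.isSelfSimilarEulerVorticityProfile.fderiv_apply_curl_eq_of_mem_nodalSet hz₀N, add_smul, one_smul,
      add_comm]
  have htr : LinearMap.trace ℝ _ ((fderiv ℝ W z₀ : EuclideanSpace ℝ (Fin 3) →L[ℝ] EuclideanSpace ℝ (Fin 3)) :
      EuclideanSpace ℝ (Fin 3) →ₗ[ℝ] EuclideanSpace ℝ (Fin 3)) = 3 * γ := by
    have hdiv : LinearMap.trace ℝ _ ((fderiv ℝ V z₀ : EuclideanSpace ℝ (Fin 3) →L[ℝ] EuclideanSpace ℝ (Fin 3)) :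
        EuclideanSpace ℝ (Fin 3) →ₗ[ℝ] EuclideanSpace ℝ (Fin 3)) = 0 := hprof.divFree z₀
    rw [hDV, ContinuousLinearMap.toLinearMap_add, ContinuousLinearMap.toLinearMap_smul, map_add,
      map_smul, hdiv, ContinuousLinearMap.coe_id, LinearMap.trace_id, finrank_euclideanSpace,
      Fintype.card_fin]
    norm_num [smul_eq_mul]
    ring
  obtain ⟨T, hT⟩ := exists_borderedEquiv_of_eigen_simple (fderiv ℝ W z₀) hΩ he (lam := 1 + γ) (t := 3 * γ)
    (by linarith) hAω hLe htr (by linarith)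
  exact tendsto_flow_atBot_of_bordered_clusterPt hV hK hprof hM hP hγ hγ2 x hz₀ he hLe T hT

/-- **NO DRIFT AT A BAD LIMIT NODE** (vortical or not). [folklore] -/
theorem tendsto_flow_atBot_of_badClusterPt (hV : ContDiff ℝ ∞ V) {K : ℝ}
    (hK : ∀ y, ‖fderiv ℝ V y‖ ≤ K) (hprof : IsSelfSimilarEulerProfile γ 0 V P) {M P₀ : ℝ} (hM : ∀ y, ‖V y‖ ≤ M)
    (hP : ∀ y, P y ≤ P₀) (hγ : 0 < γ) (hγ2 : γ < 1 / 2) (x : EuclideanSpace ℝ (Fin 3))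
    {z₀ : EuclideanSpace ℝ (Fin 3)}
    (hz₀ : MapClusterPt z₀ atBot fun s => ODE.evolutionMap (fun _ : ℝ => selfSimilarTransport γ 0 V) 0 s x)
    {w : EuclideanSpace ℝ (Fin 3)} (hw : ‖w‖ = 1) (hbad : 1 ≤ ⟪fderiv ℝ V z₀ w, w⟫) :
    ∃ z ∈ selfSimilarNodalSet γ 0 V,
      Tendsto (fun s => ODE.evolutionMap (fun _ : ℝ => selfSimilarTransport γ 0 V) 0 s x) atBot (𝓝 z) := by
  by_cases hΩ : curl V z₀ = 0
  · exact tendsto_flow_atBot_of_nonvortical_badClusterPt hV hK hprof hM hP hγ hγ2 x hz₀ hΩ hw hbad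
  · exact tendsto_flow_atBot_of_vortical_clusterPt hV hK hprof hM hP hγ hγ2 x hz₀ hΩ

/-- **EVERY VORTICAL PARTICLE'S BACKWARD TRAJECTORY CONVERGES TO A SINGLE BAD STAGNATION POINT** (`0 < γ < ½`, `V`
smooth self-similar Euler profile with CIV's far field (3.8)).  ns-typeII-p1's LIMIT-SET KILL
(`NodalContinuum.exists_badNode_mapClusterPt_of_curl_ne_zero`) gives a BAD limit node; `tendsto_flow_atBot_of_badClusterPt`
gives convergence; the limit is that node.  This is hypothesis (i) of ns-typeII-p3's
`eq_zero_of_driftCoordinate_of_dominatedBlock_badNodes` made unconditional for the particles that matter.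
[cite: ConstantinIgnatovaVicol2026Putative, §3.5 Thm 3.10 (structure of backward self-similar trajectories; proved here without the outgoing property)] -/
theorem tendsto_flow_atBot_of_curl_ne_zero (hV : ContDiff ℝ ∞ V) (hprof : IsSelfSimilarEulerProfile γ 0 V P)
    (hγ : 0 < γ) (hγ2 : γ < 1 / 2) {C₀ : ℝ} (hfar : HasSelfSimilarFarFieldWith γ 0 C₀ V)
    {x : EuclideanSpace ℝ (Fin 3)} (hx : curl V x ≠ 0) :
    ∃ z ∈ selfSimilarNodalSet γ 0 V, (∃ w : EuclideanSpace ℝ (Fin 3), ‖w‖ = 1 ∧ 1 ≤ ⟪fderiv ℝ V z w, w⟫) ∧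
      Tendsto (fun s => ODE.evolutionMap (fun _ : ℝ => selfSimilarTransport γ 0 V) 0 s x) atBot (𝓝 z) := by
  set Φ := ODE.evolutionMap (fun _ : ℝ => selfSimilarTransport γ 0 V) 0 with hΦ
  have hK : ∀ y, ‖fderiv ℝ V y‖ ≤ C₀ := norm_fderiv_le_const_of_farField hγ hfar
  have hM : ∀ y, ‖V y‖ ≤ C₀ := norm_le_const_of_farField hγ (by linarith) hfar
  have hP : ∀ y, P y ≤ P 0 + C₀ * (1 + C₀) * (γ / (1 - 2 * γ)) :=
    hprof.pressure_le_of_hasSelfSimilarFarFieldWith hγ hγ2 hfar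
  have hLip := lipschitzWith_selfSimilarTransport (γ := γ) hV hK
  obtain ⟨z', hz'N, hcl', hbad', -⟩ :=
    NodalContinuum.exists_badNode_mapClusterPt_of_curl_ne_zero hprof hγ (ne_of_lt hγ2) hfar hLip hx
  have hcl : MapClusterPt z' atBot (fun s => Φ s x) := by
    have e : (fun t : ℝ => ODE.lipschitzFlow hLip x (-t)) = (fun s => Φ s x) ∘ Neg.neg := by
      funext t
      simp only [Function.comp_apply, hΦ, ODE.evolutionMap_const_zero_eq_lipschitzFlow hLip]
    rw [e, mapClusterPt_comp, Filter.map_neg_atTop] at hcl'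
    exact hcl'
  obtain ⟨w, hw, hbadw⟩ := hbad'
  obtain ⟨z, hzN, hz⟩ := tendsto_flow_atBot_of_badClusterPt hV hK hprof hM hP hγ hγ2 x hcl hw hbadw
  -- the limit is the bad cluster point
  have hzz' : z' = z := eq_of_nhds_neBot (hcl.clusterPt.mono hz)
  exact ⟨z, hzN, ⟨w, hw, hzz' ▸ hbadw⟩, hz⟩

end Profile

end Summit.NavierStokesRegularity.NavierStokesRegularity.Theorems.PowerGaugeEulerLiouville.NoDrift

end
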